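import Mathlib
import Literature.NumberTheory.Transcendental.ZagierDilogarithmConjecture
import Summits.KontsevichZagierPeriods.KontsevichZagierPeriods.Theorems.HyperbolicBlochZagierDilogarithmConjectureStubTwoSaturation
import Summits.KontsevichZagierPeriods.KontsevichZagierPeriods.Theorems.HyperbolicBlochZagierDilogarithmConjectureStubBorelSlice
import HarnessLib

/-!
# One complex place ⇒ signed-permutation symmetry of the Galois twists

Stub `stub_onePlaceSigned` of the line `kummer-clausen-linearisation` (reshape c2, "Galois descent")
for the crux `ZagierDilogarithmConjecture` (stmt-KontsevichZagierPeriods-10550, route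
`HyperbolicBloch`).

Write `ℚ̄ := algebraicClosure ℚ ℂ ⊆ ℂ` (an `IntermediateField ℚ ℂ`). Let `z₁,…,z_k ∈ ℂ` lie in a
number field `K ⊂ ℂ` (finite-dimensional over `ℚ`) with ONE complex place in the weak sense of lead
c1's Borel slice: every ring homomorphism `K → ℂ` is the inclusion, its complex conjugate, or
real-valued (`K` need not be closed under complex conjugation). Let `σ : ℚ̄ →ₐ[ℚ] ℂ` and let
`wᵢ, w'ᵢ ∈ ℚ̄` be lifts of `zᵢ, z̄ᵢ`.

**`stub_onePlaceSigned`.** Each of the two families `(σ wᵢ)ᵢ` and `(σ w'ᵢ)ᵢ` is entirely real, or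
equal to `(z_{π i})ᵢ`, or to `(z̄_{π i})ᵢ`, for a coefficient-preserving permutation `π` — in fact
with `π = 1`.

Proof. `K` is algebraic over `ℚ` (finite-dimensional), so `K ≤ ℚ̄`. Restricting `σ` along the
inclusion `K → ℚ̄` gives `τ : K →+* ℂ` with `σ wᵢ = τ zᵢ` (the lift `wᵢ` IS the image of `zᵢ`, the
coercion `ℚ̄ → ℂ` being injective); the trichotomy for `τ` is the claim for the first family.
Complex conjugation restricts to a ring endomorphism `c` of `ℚ̄` (`exists_conj_ringHom`; `ℚ̄` is
conjugation-closed since conjugation is a `ℚ`-algebra map), and `τ' := σ ∘ c ∘ (K ↪ ℚ̄)` has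
`σ w'ᵢ = τ' zᵢ`; the trichotomy for `τ'` is the claim for the second family. This is block (ii) of
lead c1's `stub_borelSlice`, isolated.

Sources: folklore Galois theory (restriction of embeddings); Zagier 2007 Ch. I §§3–4 for context.
Not here: the passage from signed-permutation symmetry to self-similarity and to the conjecture
(`stub_signedPermutation`, `stub_selfSimilar`, `stub_galoisDescent` — separate stubs of the line).
-/

noncomputable section

open scoped BigOperators ComplexConjugate
open Literature.NumberTheory.Transcendental

namespace Summit.KontsevichZagierPeriods.HyperbolicBloch.ZagierDilogarithmGaloisDescent

open Summit.KontsevichZagierPeriods.HyperbolicBloch.ZagierDilogarithm (exists_conj_ringHom)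

/-- **One place ⇒ signed identity permutation, for one family.** If `τ : K →+* ℂ` is the inclusion,
its conjugate, or real-valued, and `vᵢ = τ zᵢ` for points `zᵢ ∈ K`, then the family `(vᵢ)` is real,
or equals `(z_{π i})`, or `(z̄_{π i})`, with the (coefficient-preserving) permutation `π = 1`.
[folklore] -/
theorem onePlace_family {K : IntermediateField ℚ ℂ} (τ : K →+* ℂ)
    (hτ : (∀ x : K, τ x = (x : ℂ)) ∨ (∀ x : K, τ x = conj (x : ℂ)) ∨ (∀ x : K, (τ x).im = 0))
    {k : ℕ} (z : Fin k → ℂ) (n : Fin k → ℤ) (hz : ∀ i, z i ∈ K) (v : Fin k → ℂ)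
    (hv : ∀ i, v i = τ ⟨z i, hz i⟩) :
    (∀ i, (v i).im = 0) ∨
      (∃ π : Equiv.Perm (Fin k), (∀ i, n (π i) = n i) ∧ ∀ i, v i = z (π i)) ∨
      (∃ π : Equiv.Perm (Fin k), (∀ i, n (π i) = n i) ∧ ∀ i, v i = conj (z (π i))) := by
  rcases hτ with h | h | h
  · exact Or.inr (Or.inl ⟨Equiv.refl _, fun _ => rfl, fun i => by rw [hv, h]; rfl⟩)
  · exact Or.inr (Or.inr ⟨Equiv.refl _, fun _ => rfl, fun i => by rw [hv, h]; rfl⟩)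
  · exact Or.inl fun i => by rw [hv]; exact h _

/-- **The lifts to `Q` of points of a subfield `K ≤ Q`, and their conjugates, as images of `K`.**
For intermediate fields `K ≤ Q` of `ℂ/ℚ`, a ring endomorphism `c` of `Q` lifting complex
conjugation, and `zᵢ ∈ K` with lifts `wᵢ, w'ᵢ ∈ Q` of `zᵢ, z̄ᵢ`: for every ring homomorphism
`σ : Q → ℂ`, `σ wᵢ = (σ ∘ ι) zᵢ` and `σ w'ᵢ = (σ ∘ c ∘ ι) zᵢ`, `ι : K → Q` the inclusion (the
coercion `Q → ℂ` is injective). [folklore] -/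
theorem onePlace_lifts {K Q : IntermediateField ℚ ℂ} (hKQ : K ≤ Q) (c : Q →+* Q)
    (hc : ∀ x : Q, ((c x : Q) : ℂ) = conj (x : ℂ)) (σ : Q →+* ℂ)
    {k : ℕ} (z : Fin k → ℂ) (hz : ∀ i, z i ∈ K) (w w' : Fin k → Q)
    (hw : ∀ i, (w i : ℂ) = z i) (hw' : ∀ i, (w' i : ℂ) = conj (z i)) :
    (∀ i, σ (w i) = (σ.comp (IntermediateField.inclusion hKQ).toRingHom) ⟨z i, hz i⟩) ∧
      ∀ i, σ (w' i) =
        ((σ.comp c).comp (IntermediateField.inclusion hKQ).toRingHom) ⟨z i, hz i⟩ := by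
  refine ⟨fun i => ?_, fun i => ?_⟩
  · have e : w i = IntermediateField.inclusion hKQ ⟨z i, hz i⟩ := Subtype.ext (hw i)
    rw [e]
    rfl
  · have e : w' i = c (IntermediateField.inclusion hKQ ⟨z i, hz i⟩) :=
      Subtype.ext (by rw [hc]; exact hw' i)
    rw [e]
    rfl

/-- **One complex place ⇒ signed-permutation symmetry** (stub `stub_onePlaceSigned` of line
`kummer-clausen-linearisation`). If the `zᵢ` lie in a number field `K ⊂ ℂ` every ring homomorphism
`K → ℂ` of which is the inclusion, its conjugate, or real-valued (`K` need not be
conjugation-closed), then for every `ℚ`-algebra map `σ : ℚ̄ → ℂ` (`ℚ̄ = algebraicClosure ℚ ℂ`) and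
lifts `wᵢ, w'ᵢ ∈ ℚ̄` of `zᵢ, z̄ᵢ`, each of the families `(σ wᵢ)ᵢ`, `(σ w'ᵢ)ᵢ` is real, or
`(z_{π i})ᵢ`, or `(z̄_{π i})ᵢ` for a coefficient-preserving permutation `π` (here `π = 1`):
restrict `σ`, resp. `σ ∘ conj`, to `K ≤ ℚ̄`. [folklore] -/
theorem stub_onePlaceSigned :
    ∀ (k : ℕ) (z : Fin k → ℂ) (n : Fin k → ℤ),
      (∃ K : IntermediateField ℚ ℂ, FiniteDimensional ℚ K ∧ (∀ i, z i ∈ K) ∧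
          ∀ σ : K →+* ℂ, (∀ x : K, σ x = (x : ℂ)) ∨ (∀ x : K, σ x = (starRingEnd ℂ) (x : ℂ)) ∨
            (∀ x : K, (σ x).im = 0)) →
        ∀ (σ : ↥(algebraicClosure ℚ ℂ) →ₐ[ℚ] ℂ) (w w' : Fin k → ↥(algebraicClosure ℚ ℂ)),
          (∀ i, (w i : ℂ) = z i) → (∀ i, (w' i : ℂ) = conj (z i)) →
          ((∀ i, (σ (w i)).im = 0) ∨
            (∃ π : Equiv.Perm (Fin k), (∀ i, n (π i) = n i) ∧ ∀ i, σ (w i) = z (π i)) ∨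
            (∃ π : Equiv.Perm (Fin k), (∀ i, n (π i) = n i) ∧ ∀ i, σ (w i) = conj (z (π i)))) ∧
          ((∀ i, (σ (w' i)).im = 0) ∨
            (∃ π : Equiv.Perm (Fin k), (∀ i, n (π i) = n i) ∧ ∀ i, σ (w' i) = z (π i)) ∨
            (∃ π : Equiv.Perm (Fin k), (∀ i, n (π i) = n i) ∧ ∀ i, σ (w' i) = conj (z (π i)))) := by
  intro k z n hK σ w w' hw hw'
  obtain ⟨K, hKfd, hzK, hKσ⟩ := hK
  -- `K ≤ ℚ̄`: a finite-dimensional intermediate field is algebraic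
  have hQ : ∀ x, x ∈ algebraicClosure ℚ ℂ ↔ IsAlgebraic ℚ x := fun _ => mem_algebraicClosure_iff
  haveI : FiniteDimensional ℚ K := hKfd
  have hKQ : K ≤ algebraicClosure ℚ ℂ := by
    intro x hx
    rw [hQ]
    have h1 : IsAlgebraic ℚ (⟨x, hx⟩ : K) := Algebra.IsAlgebraic.isAlgebraic _
    exact IntermediateField.isAlgebraic_iff.1 h1
  -- complex conjugation restricts to `ℚ̄`
  have hQc : ∀ x, x ∈ algebraicClosure ℚ ℂ → conj x ∈ algebraicClosure ℚ ℂ := fun x hx =>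
    (hQ _).2 (by simpa using ((hQ x).1 hx).algHom (starRingEnd ℂ).toRatAlgHom)
  obtain ⟨cQ, hcQ⟩ := exists_conj_ringHom (K := algebraicClosure ℚ ℂ) hQc
  -- the two restricted embeddings of `K`
  obtain ⟨h1, h2⟩ := onePlace_lifts hKQ cQ hcQ (σ : ↥(algebraicClosure ℚ ℂ) →+* ℂ) z hzK w w' hw hw'
  exact ⟨onePlace_family _ (hKσ _) z n hzK _ h1, onePlace_family _ (hKσ _) z n hzK _ h2⟩

end Summit.KontsevichZagierPeriods.HyperbolicBloch.ZagierDilogarithmGaloisDescent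

end
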